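import Summits.ValiantsHypothesis.ValiantsHypothesis.Theorems.LacunarySymmetroidMatrixDescartesCensusPivotDefs
import Literature.Analysis.TotalPositivity.MultiplyPositiveProofs

/-!
# `MatrixDescartes` (stmt-ValiantsHypothesis-18050) — pivot column: the SIGNED GRAM (Cauchy–Binet) EXPANSION
# of a lacunary pencil whose letters are signed sums of rank-one terms

HONEST FRAMING.  Cell `pub-symmetroid`, seat `val-sym-mdr-p2` (gen 3); helper `--supports` the crux
`Theses.LacunarySymmetroid.MatrixDescartes`, NO closure claim.  Algebraic identity used by `…PivotResolventDescartes.lean`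
(the pivot column's CLAIMED row `Pivot.RankOneResolventDescartes`); nothing here bears on the crux in its window,
`DoorA26`/`DoorA34`, or `VP ≠ VNP`.

THE IDENTITY (`det_gramPencil`; no new definitions — the Gram pencil is written out).  For columns `col j : Fin m → ℝ`, exponents `ex j : ℕ` and real weights `sg j`
(`j : Fin N`), the GRAM PENCIL `G(X) = ∑ j, sg j · X^{ex j} · col_j col_jᵀ` (an `m × m` matrix over `ℝ[X]`) factors as
`C · diag(sg j X^{ex j}) · Cᵀ` with the constant `m × N` matrix `C = (col_j)_j`, so by the Cauchy–Binet formula (tree,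
`Literature.Analysis.TotalPositivity.det_mul_eq_sum_strictMono`)
`det G = ∑_{t : Fin m → Fin N strictly increasing} (∏ a, sg (t a) X^{ex (t a)}) · det(C_t)²`
— a signed sum of MONOMIALS with square coefficients.  Every real symmetric lacunary pencil whose letters are written as
signed sums of rank-one matrices is such a Gram pencil; with all `sg j = 1` the determinant is a posynomial (no positive
zero), and with ONE negative column the negative coefficients are confined to the monomials through that column
(`…PivotResolventDescartes`).  [folklore] Cauchy–Binet.
-/

-- layout Summits/ValiantsHypothesis/ValiantsHypothesis forces the duplicated namespace component
set_option linter.dupNamespace false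

namespace Summit.ValiantsHypothesis.ValiantsHypothesis.Theorems.LacunarySymmetroidMatrixDescartes.Pivot

open Polynomial Matrix Finset
open scoped BigOperators

namespace GramExpansion

variable {m N : ℕ}

/-- Factorisation `G = C · diag(w) · Cᵀ` of the Gram pencil `∑ j, (sg j · X^{ex j}) • (col_j col_jᵀ)`, with the
constant column matrix `C = (col_j)_j` and the weights `sg j · X^{ex j}`. [folklore] -/
theorem gramPencil_eq_mul (col : Fin N → Fin m → ℝ) (ex : Fin N → ℕ) (sg : Fin N → ℝ) :
    (∑ j, (Polynomial.C (sg j) * (X : ℝ[X]) ^ ex j) • (Matrix.vecMulVec (col j) (col j)).map Polynomial.C)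
      = (Matrix.of fun i j => Polynomial.C (col j i) : Matrix (Fin m) (Fin N) ℝ[X])
        * (Matrix.diagonal (fun j => Polynomial.C (sg j) * (X : ℝ[X]) ^ ex j)
          * (Matrix.of fun i j => Polynomial.C (col j i) : Matrix (Fin m) (Fin N) ℝ[X])ᵀ) := by
  refine Matrix.ext fun i i' => ?_
  have hL : (∑ j, (Polynomial.C (sg j) * (X : ℝ[X]) ^ ex j) • (Matrix.vecMulVec (col j) (col j)).map Polynomial.C)
        i i'
      = ∑ j, Polynomial.C (sg j) * (X : ℝ[X]) ^ ex j * Polynomial.C (col j i * col j i') := by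
    rw [Matrix.sum_apply]
    refine Finset.sum_congr rfl fun j _ => ?_
    simp only [Matrix.smul_apply, Matrix.map_apply, Matrix.vecMulVec_apply, smul_eq_mul]
  have hR : ((Matrix.of fun i j => Polynomial.C (col j i) : Matrix (Fin m) (Fin N) ℝ[X])
        * (Matrix.diagonal (fun j => Polynomial.C (sg j) * (X : ℝ[X]) ^ ex j)
          * (Matrix.of fun i j => Polynomial.C (col j i) : Matrix (Fin m) (Fin N) ℝ[X])ᵀ)) i i'
      = ∑ j, Polynomial.C (col j i) * (Polynomial.C (sg j) * (X : ℝ[X]) ^ ex j * Polynomial.C (col j i')) := by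
    rw [Matrix.mul_apply]
    refine Finset.sum_congr rfl fun j _ => ?_
    simp only [Matrix.diagonal_mul, Matrix.transpose_apply, Matrix.of_apply]
  rw [hL, hR]
  apply Finset.sum_congr rfl
  intro j _
  rw [Polynomial.C_mul]
  ring

/-- Row selection commutes with the diagonal scaling: `(diag(w) · Cᵀ)[t, ·] = diag(w ∘ t) · (C[·, t])ᵀ`. [folklore] -/
theorem submatrix_diagonal_mul_transpose (col : Fin N → Fin m → ℝ) (w : Fin N → ℝ[X]) (t : Fin m → Fin N) :
    (Matrix.diagonal w * (Matrix.of fun i j => Polynomial.C (col j i) : Matrix (Fin m) (Fin N) ℝ[X])ᵀ).submatrix t id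
      = Matrix.diagonal (w ∘ t)
        * ((Matrix.of fun i j => Polynomial.C (col j i) : Matrix (Fin m) (Fin N) ℝ[X]).submatrix id t)ᵀ := by
  refine Matrix.ext fun a i => ?_
  simp only [Matrix.submatrix_apply, id, Matrix.diagonal_mul, Matrix.transpose_apply, Function.comp]

/-- The selected column block is the image of a real matrix under `C`. [folklore] -/
theorem submatrix_colMatrix_eq_map (col : Fin N → Fin m → ℝ) (t : Fin m → Fin N) :
    (Matrix.of fun i j => Polynomial.C (col j i) : Matrix (Fin m) (Fin N) ℝ[X]).submatrix id t
      = (Polynomial.C : ℝ →+* ℝ[X]).mapMatrix (Matrix.of fun i a => col (t a) i) := by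
  refine Matrix.ext fun i a => ?_
  simp

/-- **Signed Gram (Cauchy–Binet) expansion.**
`det (∑ j, (sg j · X^{ex j}) • col_j col_jᵀ) = ∑_{t strictly increasing} (∏ a, sg (t a) X^{ex (t a)}) · C(det(C_t)²)`
with `C_t = (col (t a) i)_{i,a}`. [folklore] -/
theorem det_gramPencil (col : Fin N → Fin m → ℝ) (ex : Fin N → ℕ) (sg : Fin N → ℝ) :
    (∑ j, (Polynomial.C (sg j) * (X : ℝ[X]) ^ ex j) • (Matrix.vecMulVec (col j) (col j)).map Polynomial.C).det
      = ∑ t ∈ (Finset.univ : Finset (Fin m → Fin N)).filter (fun t => StrictMono t),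
          (∏ a, (Polynomial.C (sg (t a)) * (X : ℝ[X]) ^ ex (t a)))
            * Polynomial.C ((Matrix.of fun i a => col (t a) i).det ^ 2) := by
  classical
  rw [gramPencil_eq_mul, Literature.Analysis.TotalPositivity.det_mul_eq_sum_strictMono]
  refine Finset.sum_congr rfl fun t _ => ?_
  rw [submatrix_diagonal_mul_transpose, Matrix.det_mul, Matrix.det_diagonal, Matrix.det_transpose,
    submatrix_colMatrix_eq_map, ← RingHom.map_det]
  simp only [Function.comp, map_pow]
  ring

/-- Each term of the expansion is a monomial: `∏ a, sg (t a) X^{ex (t a)} = C(∏ a, sg (t a)) · X^{∑ a, ex (t a)}`.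
[folklore] -/
theorem prod_weight (ex : Fin N → ℕ) (sg : Fin N → ℝ) (t : Fin m → Fin N) :
    ∏ a, (Polynomial.C (sg (t a)) * (X : ℝ[X]) ^ ex (t a))
      = Polynomial.C (∏ a, sg (t a)) * (X : ℝ[X]) ^ (∑ a, ex (t a)) := by
  simp only [Finset.prod_mul_distrib, map_prod, Finset.prod_pow_eq_pow_sum]

/-- Coefficient form of the expansion: the coefficient of `X^n` in the Gram pencil's determinant is the signed sum
of squares `∑_{t : ∑ ex (t a) = n} (∏ a, sg (t a)) · det(C_t)²`. [folklore] -/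
theorem coeff_det_gramPencil (col : Fin N → Fin m → ℝ) (ex : Fin N → ℕ) (sg : Fin N → ℝ) (n : ℕ) :
    (∑ j, (Polynomial.C (sg j) * (X : ℝ[X]) ^ ex j) • (Matrix.vecMulVec (col j) (col j)).map Polynomial.C).det.coeff n
      = ∑ t ∈ (Finset.univ : Finset (Fin m → Fin N)).filter (fun t => StrictMono t),
          if n = ∑ a, ex (t a) then (∏ a, sg (t a)) * (Matrix.of fun i a => col (t a) i).det ^ 2 else 0 := by
  rw [det_gramPencil, Polynomial.finsetSum_coeff]
  refine Finset.sum_congr rfl fun t _ => ?_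
  rw [prod_weight, mul_comm (Polynomial.C _) _, mul_assoc, ← map_mul, mul_comm, Polynomial.coeff_C_mul_X_pow]

end GramExpansion

end Summit.ValiantsHypothesis.ValiantsHypothesis.Theorems.LacunarySymmetroidMatrixDescartes.Pivot
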